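import Mathlib
import HarnessLib
import Literature.Analysis.FluidPDE.KNSSTypeIRateLimit
import Summits.NavierStokesRegularity.NavierStokesRegularity.Theorems.LocalVelCompTubeDoorLocalPointZoomVelSlicesDiag
import Summits.NavierStokesRegularity.NavierStokesRegularity.Theorems.PoloidalWindowDoorPoloidalWindowRigidityAxisymmetric
import Summits.NavierStokesRegularity.NavierStokesRegularity.Theorems.PoloidalWindowDoorPoloidalWindowRigidityOneSlice

/-!
# The door family in the AXISYMMETRIC regime (swirl ALLOWED): every OFF-AXIS locally Type-I point is backward bounded

Cell ns-regularity-ideate, seat p6 (route-directed support for the door family of LADDER-NS N0; companion of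
`…LocalHelicityTubeDoorAxisymNoSwirlCase` (no swirl, any point) and `…LocalVelCompTubeDoorOrthogonalField`).  For an
axisymmetric flow WITH swirl no velocity component vanishes, so the strict-shadow stratum is not available; instead the
rotations about the symmetry axis act on the zoom chart at an off-axis point `x₀` as TRANSLATIONS in the limit:
`R_{λⱼ l}(x₀ + λⱼ y) = x₀ + λⱼ yⱼ` with `yⱼ → y + l • J x₀` (`J = rotGen`, `(d/dθ) R_θ x₀|₀ = J x₀`, tree
`hasDerivAt_rotZ_zero`).  Reading the zoom along the MOVING points `yⱼ` needs the DIAGONAL velocity zoom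
(`…LocalVelCompTubeDoorLocalPointZoomVelSlicesDiag.localPointZoomVelSlicesDiag`, this seat); equivariance
`u(t, R_θ x) = R_θ u(t, x)` and joint continuity of `(θ, w) ↦ R_θ w` (tree `continuous_rotZ_uncurry`) then give
`v(s, y + l • J x₀) = v(s, y)` for all `l`: the profile is translation-invariant along `J x₀ ≠ 0` on every slice, a
settled stratum (tree `nonflatLiouville_of_translate_eq_slice`, KNSS 2009 Thm 5.1 in the class), contradicting backward
singularity.

* `isBackwardBoundedAt_of_localTypeI_axisymmetric_offAxis` — **classical Leray–Hopf solution from a rapidly decaying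
  datum, axisymmetric (about the `x₂`-axis, swirl allowed) at every time, locally Type I at `(x₀, T)` with `x₀` OFF the
  axis ⇒ backward bounded at `(x₀, T)`.**

Honest placement: inside the printed regime (singular points of axisymmetric suitable solutions lie on the axis — CKN
1982; Seregin–Šverák 2009 for the Type-I statement); new only as a kernel theorem by the doors' zoom/strata mechanism.
The ON-axis case with swirl is Seregin–Šverák 2009 Thm 1.1 (tree barrier `AxisymmetricTypeIExclusion_holds`, in the
Seregin–Šverák vocabulary; not restated here).

WHAT THIS IS NOT: not a claim about Navier–Stokes regularity (Clay A) — a local statement CONDITIONAL on local Type I in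
the axisymmetric class, off the axis (bears_on LADDER-NS N0).
-/

noncomputable section

-- the summit and its single sub-problem share the name (CONVENTIONS §1), as in every Theorems file
set_option linter.dupNamespace false

namespace Summit.NavierStokesRegularity.NavierStokesRegularity.Theorems.LocalVelCompTubeDoorAxisymOffAxis

open MeasureTheory Set Function Filter Topology TopologicalSpace Metric
open scoped RealInnerProductSpace InnerProductSpace
open Literature.Analysis Literature.Analysis.FluidPDE
open Summit.NavierStokesRegularity.NavierStokesRegularity.Theorems.LocalVelCompTubeDoorLocalPointZoomVelSlicesDiag
open Summit.NavierStokesRegularity.NavierStokesRegularity.Theorems.PoloidalWindowDoorPoloidalWindowRigidityFlat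
open Summit.NavierStokesRegularity.NavierStokesRegularity.Theorems.PoloidalWindowDoorPoloidalWindowRigidityOneSlice

/-- The difference quotients of the rotation orbit of `x₀` along `θⱼ = λⱼ l`: `λⱼ⁻¹ • (R_{λⱼ l} x₀ − x₀) → l • J x₀`
as `λⱼ → 0⁺`. -/
theorem tendsto_rotZ_slope {lam : ℕ → ℝ} (hlam : ∀ j, 0 < lam j) (hlam0 : Tendsto lam atTop (𝓝 0))
    (x₀ : EuclideanSpace ℝ (Fin 3)) (l : ℝ) :
    Tendsto (fun j => (lam j)⁻¹ • (rotZ (lam j * l) x₀ - x₀)) atTop (𝓝 (l • rotGen x₀)) := by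
  by_cases hl : l = 0
  · subst hl
    simp only [mul_zero, rotZ_zero, sub_self, smul_zero, zero_smul]
    exact tendsto_const_nhds
  -- the slope of `θ ↦ R_θ x₀` at `0` along `θⱼ = λⱼ l ≠ 0`, `θⱼ → 0`
  have hθ : Tendsto (fun j => lam j * l) atTop (𝓝[≠] 0) := by
    refine tendsto_nhdsWithin_of_tendsto_nhds_of_eventually_within _ ?_ (Eventually.of_forall fun j => ?_)
    · simpa using hlam0.mul_const l
    · exact mul_ne_zero (hlam j).ne' hl
  have hslope := (hasDerivAt_rotZ_zero x₀).tendsto_slope_zero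
  have hcomp := (hslope.comp hθ).const_smul l
  refine hcomp.congr fun j => ?_
  simp only [Function.comp_def, zero_add, rotZ_zero, smul_smul]
  congr 1
  field_simp [(hlam j).ne', hl]

/-- **Axisymmetric (swirl allowed) + local Type I at an OFF-axis point ⇒ backward bounded there.** -/
theorem isBackwardBoundedAt_of_localTypeI_axisymmetric_offAxis
    (ν T : ℝ) (hν : 0 < ν) (hT : 0 < T) (u : ℝ → EuclideanSpace ℝ (Fin 3) → EuclideanSpace ℝ (Fin 3))
    (p : ℝ → EuclideanSpace ℝ (Fin 3) → ℝ)
    (hcl : IsClassicalNSSolutionOn (Set.Ico 0 T) ν 0 u p) (hLH : IsLerayHopfOn T ν 0 (u 0) u)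
    (hdec : HasRapidSpatialDecay (u 0)) (haxi : ∀ t, IsAxisymmetric (u t))
    (x₀ : EuclideanSpace ℝ (Fin 3)) (hx₀ : rotGen x₀ ≠ 0) (ρ M : ℝ) (hρ : 0 < ρ)
    (hM : ∀ t ∈ Set.Ico 0 T, T - ρ ^ 2 < t → ∀ x ∈ Metric.ball x₀ ρ, ‖u t x‖ * Real.sqrt (ν * (T - t)) ≤ M) :
    IsBackwardBoundedAt u T x₀ := by
  by_contra hnot
  obtain ⟨C, v, lam, hlam, hlam0, ⟨hrate, hcont, hmild, hdiv⟩, hsing, hconv⟩ :=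
    localPointZoomVelSlicesDiag ν T hν hT u p hcl hLH hdec x₀ ρ M hρ hM hnot
  -- translation invariance of every slice along `e = J x₀`
  have htr : ∀ s < 0, ∀ (y : EuclideanSpace ℝ (Fin 3)) (l : ℝ), v s (y + l • rotGen x₀) = v s y := by
    intro s hs y l
    -- the moving points `yⱼ = λⱼ⁻¹ • (R_{θⱼ} x₀ − x₀) + R_{θⱼ} y → l • J x₀ + y`, `θⱼ = λⱼ l`
    set θ : ℕ → ℝ := fun j => lam j * l with hθdef
    set yseq : ℕ → EuclideanSpace ℝ (Fin 3) := fun j => (lam j)⁻¹ • (rotZ (θ j) x₀ - x₀) + rotZ (θ j) y with hyseqdef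
    have hθ0 : Tendsto θ atTop (𝓝 0) := by simpa [hθdef] using hlam0.mul_const l
    have hRy : Tendsto (fun j => rotZ (θ j) y) atTop (𝓝 y) := by
      have h := (continuous_rotZ_uncurry.tendsto ((0 : ℝ), y)).comp (hθ0.prodMk_nhds tendsto_const_nhds)
      simpa [Function.comp_def, rotZ_zero] using h
    have hyseq : Tendsto yseq atTop (𝓝 (y + l • rotGen x₀)) := by
      have h := (tendsto_rotZ_slope hlam hlam0 x₀ l).add hRy
      rw [add_comm (l • rotGen x₀) y] at h
      exact h
    -- the identity `x₀ + λⱼ yⱼ = R_{θⱼ} (x₀ + λⱼ y)`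
    have hpts : ∀ j, x₀ + lam j • yseq j = rotZ (θ j) (x₀ + lam j • y) := by
      intro j
      have hl0 : lam j ≠ 0 := (hlam j).ne'
      have hlin : rotZ (θ j) (x₀ + lam j • y) = rotZ (θ j) x₀ + lam j • rotZ (θ j) y := by
        have h := map_add (rotZL (θ j)) x₀ (lam j • y)
        rw [map_smul] at h
        simpa only [rotZL_apply] using h
      rw [hlin, hyseqdef]
      simp only [smul_add, smul_smul, mul_inv_cancel₀ hl0, one_smul]
      abel
    -- the zoom along the moving points converges to `v s (y + l • J x₀)` (diagonal zoom) …
    have h1 : Tendsto (fun j => (lam j / ν) • u (T + lam j ^ 2 * s / ν) (x₀ + lam j • yseq j)) atTop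
        (𝓝 (v s (y + l • rotGen x₀))) := hconv s hs (y + l • rotGen x₀) yseq hyseq
    -- … and equals `R_{θⱼ}` of the zoom at the fixed point `y`, which converges to `R_0 (v s y) = v s y`
    have h2 : Tendsto (fun j => rotZ (θ j) ((lam j / ν) • u (T + lam j ^ 2 * s / ν) (x₀ + lam j • y))) atTop
        (𝓝 (v s y)) := by
      have h := (continuous_rotZ_uncurry.tendsto ((0 : ℝ), v s y)).comp ((hθ0).prodMk_nhds (hconv s hs y (fun _ => y)
        tendsto_const_nhds))
      simpa [Function.comp_def, rotZ_zero] using h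
    have heq : (fun j => (lam j / ν) • u (T + lam j ^ 2 * s / ν) (x₀ + lam j • yseq j)) =
        fun j => rotZ (θ j) ((lam j / ν) • u (T + lam j ^ 2 * s / ν) (x₀ + lam j • y)) := by
      funext j
      rw [hpts j, haxi _ (θ j) (x₀ + lam j • y)]
      have h := map_smul (rotZL (θ j)) (lam j / ν) (u (T + lam j ^ 2 * s / ν) (x₀ + lam j • y))
      simpa only [rotZL_apply] using h.symm
    rw [heq] at h1
    exact tendsto_nhds_unique h1 h2
  exact (nonflatLiouville_of_translate_eq_slice hrate hcont hmild hdiv (s := -1) (by norm_num) hx₀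
    (fun y l => htr (-1) (by norm_num) y l)) hsing

end Summit.NavierStokesRegularity.NavierStokesRegularity.Theorems.LocalVelCompTubeDoorAxisymOffAxis

end
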